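import Literature.NumberTheory.GaloisRepresentations.LocalWeilDatum
import Literature.NumberTheory.GaloisRepresentations.TameInertiaCyclicProofs
import Literature.NumberTheory.GaloisRepresentations.LocalIntegralClosureProofs
import Mathlib.NumberTheory.RamificationInertia.Basic
import HarnessLib

/-!
# The Weil datum of a non-archimedean local field, IV: integers, ramification and residue degree of a finite subextension (`e f = n`)

For a non-archimedean local field `F` and a *finite separable* subextension `K ⊆ F̄`, this file
sets up the arithmetic of `K` needed for the henselian-valuation axiom of Neukirch's abstract
class field theory (`AbstractClassFieldTheory.WeilDatum.dvd_v_norm / exists_v_norm_eq`,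
Neukirch IV (4.6) (ii): `v(N_{K|F} K^*) = f_K ℤ`) and for the identification of the abstract
inertia degree `f_K` (least positive Frobenius degree in `G_K`) with the residue degree:

* `O_K = integralClosure 𝒪[F] K` is a local ring for *every* subextension `K` (no finiteness or
  Galois hypothesis), and a discrete valuation ring for `K/F` finite separable, with maximal ideal
  `𝔓_K = 𝔓 ∩ K` (`isLocalRing_integralClosure`, `maximalIdeal_eq_primeOf`,
  `isDiscreteValuationRing_integralClosure'`, `finite_quotient_primeOf`; these generalise the Galois-case
  results `isLocalRing_integralClosure_intermediateField`, `maximalIdeal_integralClosure`,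
  `isDiscreteValuationRing_integralClosure`, `finite_integralClosure_quotient` of
  `TameInertiaCyclicProofs.lean`: uniqueness of the maximal ideal comes from the uniqueness of the prime
  of `\bar ℤ_F` above `𝓂[F]`, `primesOver_maximalIdeal_eq_singleton_holds`, by lying over);
* the fundamental identity `e f = [K : F]` (Mathlib `Ideal.ramificationIdx_mul_inertiaDeg_of_isLocalRing`)
  with `e` read off a uniformiser (`ϖ_F = u π_K ^ e`, `ramificationIdx_eq_of_eq_unit_mul_pow`) and
  `#(O_K / 𝔓_K) = q ^ f` (`card_quotient_primeOf`);
* the normalised valuation `ord_F` (`LocalWeilDatum.ord`): `ord_eq_iff`, `ord_mul`, `ord_pow`, `ord_div`,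
  `ord_one`, `ord_eq_zero_iff`, `ord_eq_one_iff`, `ord_eq_one_of_irreducible`;
* **the valuation of norms** `ord_F (N_{K/F} a) = f · v_K(a)` (`valuation_norm_unit`,
  `ord_norm_eq_of_eq_unit_mul_pow`), hence `ord_F (N_{K/F} Kˣ) ⊆ f ℤ` (`inertiaDeg_dvd_ord_norm`) with
  `f` attained at a uniformiser of `K` (`exists_ord_norm_eq_inertiaDeg`) — Neukirch's henselian-valuation
  axiom IV (4.6) (ii), `v(N_{K|F} K^*) = f_K ℤ`, once `f` is identified with the abstract inertia degree
  (sequel `LocalWeilDatumDegree.lean`).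

## References

* J.-P. Serre, *Local Fields*, GTM 67, Ch. II §2 (Prop. 3, Cor. 1–2: `e f = n` for complete
  fields), Ch. I §4–§5. [SerreLocalFields1979]
* J. Neukirch, *Algebraic Number Theory*, Ch. II (6.8), Ch. V §1. [NeukirchANT1999]
-/

noncomputable section

open Field IsNonarchimedeanLocalField ValuativeRel
open scoped Pointwise Valued

namespace Literature.NumberTheory.GaloisRepresentations

namespace LocalWeilDatum

open GaloisRepresentations.IsNonarchimedeanLocalField

section Integers

variable (F : Type*) [Field F] [ValuativeRel F] [TopologicalSpace F] [IsNonarchimedeanLocalField F]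
variable (K : IntermediateField F (AlgebraicClosure F))

/-- The prime `𝔓_K = 𝔓 ∩ O_K` of `O_K = integralClosure 𝒪[F] K`. [folklore] -/
abbrev primeOf : Ideal (integralClosure 𝒪[F] K) :=
  (absMaximalIdeal F).comap (K.integralClosureToAbsIntegers 𝒪[F])

/-- `𝔓_K` is maximal. [folklore] -/
theorem isMaximal_primeOf : (primeOf F K).IsMaximal := by
  haveI : (absMaximalIdeal F).IsMaximal := absMaximalIdeal_isMaximal_holds F
  exact isMaximal_comap_integralClosureToAbsIntegers 𝒪[F] (absMaximalIdeal F) K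

/-- `𝔓_K ∩ 𝒪[F] = 𝓂[F]`. [folklore] -/
theorem under_primeOf : (primeOf F K).under 𝒪[F] = 𝓂[F] := by
  rw [under_comap_integralClosureToAbsIntegers, under_absMaximalIdeal_holds]

/-- `𝔓_K` lies over `𝓂[F]`. [folklore] -/
theorem primeOf_liesOver : (primeOf F K).LiesOver 𝓂[F] :=
  ⟨(under_primeOf F K).symm⟩

/-- **`O_K` is a local ring with maximal ideal `𝔓_K`** for every subextension `K ⊆ F̄` (no finiteness
or Galois hypothesis): any maximal ideal `M` of `O_K` lies under a maximal ideal of the integral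
extension `\bar ℤ_F`, which lies over `𝓂[F]` and is therefore `𝔓` (`F` is henselian:
`primesOver_maximalIdeal_eq_singleton_holds`).  Generalises
`isLocalRing_integralClosure_intermediateField` of `TameInertiaCyclicProofs.lean` (Galois case).
[cite: SerreLocalFields1979, Ch. II §2 Prop. 3] -/
theorem isLocalRing_integralClosure : IsLocalRing (integralClosure 𝒪[F] K) := by
  haveI := isMaximal_primeOf F K
  haveI : Algebra.IsIntegral 𝒪[F] (absIntegers 𝒪[F] F) := inferInstance
  refine IsLocalRing.of_unique_max_ideal ⟨primeOf F K, inferInstance, fun M hM => ?_⟩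
  -- `\bar ℤ_F` as an integral `O_K`-algebra
  let φ : integralClosure 𝒪[F] K →ₐ[𝒪[F]] absIntegers 𝒪[F] F := K.integralClosureToAbsIntegers 𝒪[F]
  letI : Algebra (integralClosure 𝒪[F] K) (absIntegers 𝒪[F] F) := φ.toRingHom.toAlgebra
  have halg : ∀ x, algebraMap (integralClosure 𝒪[F] K) (absIntegers 𝒪[F] F) x = φ x := fun _ => rfl
  letI : SMul (integralClosure 𝒪[F] K) (absIntegers 𝒪[F] F) := Algebra.toSMul
  haveI : IsScalarTower 𝒪[F] (integralClosure 𝒪[F] K) (absIntegers 𝒪[F] F) :=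
    IsScalarTower.of_algebraMap_eq fun x => by rw [halg, AlgHom.commutes]
  haveI : Algebra.IsIntegral (integralClosure 𝒪[F] K) (absIntegers 𝒪[F] F) :=
    ⟨fun x => IsIntegral.tower_top (A := integralClosure 𝒪[F] K)
      (Algebra.IsIntegral.isIntegral (R := 𝒪[F]) x)⟩
  have hker : RingHom.ker (algebraMap (integralClosure 𝒪[F] K) (absIntegers 𝒪[F] F)) ≤ M := by
    intro x hx
    rw [RingHom.mem_ker, halg] at hx
    have : x = 0 := K.integralClosureInclusion_injective 𝒪[F] (by rw [map_zero]; exact hx)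
    rw [this]
    exact M.zero_mem
  obtain ⟨M', hM', hM'M⟩ := Ideal.exists_ideal_over_maximal_of_isIntegral M hker
  -- `M'` lies over `𝓂[F]`, hence is `𝔓`
  have hunder : M'.under 𝒪[F] = 𝓂[F] := by
    haveI : (M'.under 𝒪[F]).IsMaximal := Ideal.IsMaximal.under 𝒪[F] M'
    exact IsLocalRing.eq_maximalIdeal inferInstance
  have hmem : M' ∈ (𝓂[F]).primesOver (absIntegers 𝒪[F] F) :=
    ⟨hM'.isPrime, ⟨hunder.symm⟩⟩
  rw [primesOver_maximalIdeal_eq_singleton_holds F, Set.mem_singleton_iff] at hmem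
  rw [← hM'M, hmem]
  rfl

/-- The maximal ideal of the local ring `O_K` is `𝔓_K` (every subextension `K`; generalises
`maximalIdeal_integralClosure` of `TameInertiaCyclicProofs.lean`, Galois case). [folklore] -/
theorem maximalIdeal_eq_primeOf :
    haveI := isLocalRing_integralClosure F K
    IsLocalRing.maximalIdeal (integralClosure 𝒪[F] K) = primeOf F K := by
  haveI := isLocalRing_integralClosure F K
  haveI := isMaximal_primeOf F K
  exact (IsLocalRing.eq_maximalIdeal inferInstance).symm

variable [FiniteDimensional F K]

/-- `O_K` is a Dedekind domain for `K/F` finite separable. [folklore] -/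
theorem isDedekindDomain_integralClosure (hKs : K ≤ sepClosure F) :
    IsDedekindDomain (integralClosure 𝒪[F] K) := by
  haveI : Algebra.IsSeparable F K := (le_separableClosure_iff F (AlgebraicClosure F) K).mp hKs
  exact IsIntegralClosure.isDedekindDomain 𝒪[F] F K (integralClosure 𝒪[F] K)

/-- **`O_K` is a discrete valuation ring** for `K/F` finite separable (Dedekind, local, not a field).
The prime `'` distinguishes it from `isDiscreteValuationRing_integralClosure` of
`TameInertiaCyclicProofs.lean`, the (less general) Galois case, which this generalises.
[cite: SerreLocalFields1979, Ch. II §2 Prop. 3] -/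
theorem isDiscreteValuationRing_integralClosure' (hKs : K ≤ sepClosure F) :
    IsDiscreteValuationRing (integralClosure 𝒪[F] K) := by
  haveI := isDedekindDomain_integralClosure F K hKs
  haveI := isLocalRing_integralClosure F K
  haveI : IsPrincipalIdealRing (integralClosure 𝒪[F] K) := by
    refine IsPrincipalIdealRing.of_finite_maximals ?_
    refine (Set.finite_singleton (IsLocalRing.maximalIdeal (integralClosure 𝒪[F] K))).subset ?_
    intro M hM
    exact IsLocalRing.eq_maximalIdeal hM
  exact { not_a_field' := by rw [maximalIdeal_eq_primeOf]; exact comap_absMaximalIdeal_ne_bot F K }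

omit [TopologicalSpace F] [IsNonarchimedeanLocalField F] in
/-- `K` is the fraction field of `O_K`. [folklore] -/
theorem isFractionRing_integralClosure : IsFractionRing (integralClosure 𝒪[F] K) K :=
  IsIntegralClosure.isFractionRing_of_finite_extension 𝒪[F] F K (integralClosure 𝒪[F] K)

/-- **The fundamental identity `e f = [K : F]`** for the local ring `O_K` (Mathlib, local case of
`Ideal.sum_ramification_inertia`), with `e = ramificationIdx' 𝓂[F] 𝔓_K`, `f = inertiaDeg' 𝓂[F] 𝔓_K`.
[cite: SerreLocalFields1979, Ch. II §2 Cor. 1 to Prop. 3] -/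
theorem ramificationIdx_mul_inertiaDeg (hKs : K ≤ sepClosure F) :
    Ideal.ramificationIdx' 𝓂[F] (primeOf F K) * Ideal.inertiaDeg' 𝓂[F] (primeOf F K) =
      Module.finrank F K := by
  haveI := isDedekindDomain_integralClosure F K hKs
  haveI := isLocalRing_integralClosure F K
  haveI := module_finite_integralClosure F K
  haveI := isFractionRing_integralClosure F K
  have h := Ideal.ramificationIdx_mul_inertiaDeg_of_isLocalRing (integralClosure 𝒪[F] K) F K
    (p := 𝓂[F]) (IsDiscreteValuationRing.not_a_field 𝒪[F])
  rwa [maximalIdeal_eq_primeOf] at h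

/-- The residue field `O_K / 𝔓_K` is finite (`K/F` finite; generalises `finite_integralClosure_quotient`
of `TameInertiaCyclicProofs.lean`, which assumes separability). [folklore] -/
theorem finite_quotient_primeOf : Finite (integralClosure 𝒪[F] K ⧸ primeOf F K) := by
  haveI := primeOf_liesOver F K
  haveI := module_finite_integralClosure F K
  haveI : Finite (𝒪[F] ⧸ 𝓂[F]) := inferInstanceAs (Finite 𝓀[F])
  exact Module.finite_of_finite (𝒪[F] ⧸ 𝓂[F])

/-- **`#(O_K / 𝔓_K) = q ^ f`**, `f = inertiaDeg' 𝓂[F] 𝔓_K` the residue degree, `q = #𝓀[F]`.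
[cite: SerreLocalFields1979, Ch. I §4 (residue degree)] -/
theorem card_quotient_primeOf :
    Nat.card (integralClosure 𝒪[F] K ⧸ primeOf F K) =
      residueFieldCard F ^ Ideal.inertiaDeg' 𝓂[F] (primeOf F K) := by
  classical
  haveI := primeOf_liesOver F K
  haveI := finite_quotient_primeOf F K
  letI := Ideal.Quotient.field 𝓂[F]
  haveI : Finite (𝒪[F] ⧸ 𝓂[F]) := inferInstanceAs (Finite 𝓀[F])
  letI := Fintype.ofFinite (𝒪[F] ⧸ 𝓂[F])
  letI := Fintype.ofFinite (integralClosure 𝒪[F] K ⧸ primeOf F K)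
  have h := Module.card_eq_pow_finrank (K := 𝒪[F] ⧸ 𝓂[F]) (V := integralClosure 𝒪[F] K ⧸ primeOf F K)
  rw [← Nat.card_eq_fintype_card, ← Nat.card_eq_fintype_card] at h
  rw [Ideal.inertiaDeg'_algebraMap, h]
  rfl

/-- **The ramification index from a uniformiser**: if `ϖ_F = u π ^ e` in `O_K` with `π` irreducible
(a uniformiser of the DVR `O_K`) and `u` a unit, then `ramificationIdx' 𝓂[F] 𝔓_K = e`.
[cite: SerreLocalFields1979, Ch. I §4 (ramification index)] -/
theorem ramificationIdx_eq_of_eq_unit_mul_pow (hKs : K ≤ sepClosure F) {ϖ : 𝒪[F]} (hϖ : Irreducible ϖ)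
    {π : integralClosure 𝒪[F] K} (hπ : Irreducible π) {u : (integralClosure 𝒪[F] K)ˣ} {e : ℕ}
    (h : algebraMap 𝒪[F] (integralClosure 𝒪[F] K) ϖ = u * π ^ e) :
    Ideal.ramificationIdx' 𝓂[F] (primeOf F K) = e := by
  haveI := isDiscreteValuationRing_integralClosure' F K hKs
  haveI := isDedekindDomain_integralClosure F K hKs
  have hP : primeOf F K = Ideal.span {π} := by
    rw [← maximalIdeal_eq_primeOf, ← IsDiscreteValuationRing.irreducible_iff_uniformizer]
    exact hπ
  have hmap : Ideal.map (algebraMap 𝒪[F] (integralClosure 𝒪[F] K)) 𝓂[F] = primeOf F K ^ e := by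
    rw [(IsDiscreteValuationRing.irreducible_iff_uniformizer ϖ).mp hϖ, Ideal.map_span, Set.image_singleton,
      h, hP, Ideal.span_singleton_pow, Ideal.span_singleton_mul_left_unit u.isUnit]
  have hP0 : primeOf F K ≠ ⊥ := comap_absMaximalIdeal_ne_bot F K
  haveI := isMaximal_primeOf F K
  apply Ideal.ramificationIdx'_spec (le_of_eq hmap)
  rw [hmap]
  exact not_le_of_gt (Ideal.pow_succ_lt_pow hP0 e)

end Integers

/-! ### The normalised valuation `ord_F` -/

section Ord

variable (F : Type*) [Field F] [ValuativeRel F] [TopologicalSpace F] [IsNonarchimedeanLocalField F]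

/-- `ord x = n ↔ |x| = |ϖ|ⁿ`. [folklore] -/
theorem ord_eq_iff {x : F} (hx : x ≠ 0) (n : ℤ) : ord F x = n ↔ valuation F x = unifValue F ^ n := by
  rw [valuation_eq_unifValue_zpow_ord F hx]
  exact ((zpow_right_strictAnti₀ (unifValue_pos F) (unifValue_lt_one F)).injective.eq_iff).symm

/-- `ord (x y) = ord x + ord y`. [folklore] -/
theorem ord_mul {x y : F} (hx : x ≠ 0) (hy : y ≠ 0) : ord F (x * y) = ord F x + ord F y := by
  rw [ord_eq_iff F (mul_ne_zero hx hy), map_mul, valuation_eq_unifValue_zpow_ord F hx,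
    valuation_eq_unifValue_zpow_ord F hy, ← zpow_add₀ (unifValue_ne_zero F)]

/-- `ord 1 = 0`. [folklore] -/
theorem ord_one : ord F (1 : F) = 0 := by
  rw [ord_eq_iff F one_ne_zero, zpow_zero, map_one]

/-- `ord (x ^ n) = n ord x`. [folklore] -/
theorem ord_pow {x : F} (hx : x ≠ 0) (n : ℕ) : ord F (x ^ n) = n * ord F x := by
  induction n with
  | zero => rw [pow_zero, Nat.cast_zero, zero_mul, ord_one]
  | succ n ih => rw [pow_succ, ord_mul F (pow_ne_zero n hx) hx, ih]; push_cast; ring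

/-- `ord (x / y) = ord x - ord y`. [folklore] -/
theorem ord_div {x y : F} (hx : x ≠ 0) (hy : y ≠ 0) : ord F (x / y) = ord F x - ord F y := by
  have h := ord_mul F (div_ne_zero hx hy) hy
  rw [div_mul_cancel₀ _ hy] at h
  omega

/-- `ord x = 0 ↔ |x| = 1`. [folklore] -/
theorem ord_eq_zero_iff {x : F} (hx : x ≠ 0) : ord F x = 0 ↔ valuation F x = 1 := by
  rw [ord_eq_iff F hx, zpow_zero]

/-- `ord x = 1 ↔ x` is a uniformiser. [folklore] -/
theorem ord_eq_one_iff {x : F} (hx : x ≠ 0) : ord F x = 1 ↔ (valuation F).IsUniformizer x := by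
  rw [ord_eq_iff F hx, zpow_one, isUniformizer_iff_valuation_eq_unifValue]

/-- An irreducible element of `𝒪[F]` is a uniformiser: `|ϖ| = |π|` (it generates `𝓂[F]`, which
contains a uniformiser). [folklore] -/
theorem valuation_eq_unifValue_of_irreducible {ϖ : 𝒪[F]} (hϖ : Irreducible ϖ) :
    valuation F (ϖ : F) = unifValue F := by
  have hv := Valuation.integer.integers (valuation F)
  apply le_antisymm
  · rw [valuation_le_unifValue_iff_lt_one]
    exact hv.valuation_irreducible_lt_one hϖ
  · obtain ⟨π, hπ⟩ := exists_isUniformizer F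
    have hπ1 : valuation F (π : F) ≤ 1 := hπ.val_lt_one.le
    have hmem : (⟨(π : F), hπ1⟩ : 𝒪[F]) ∈ 𝓂[F] := by
      rw [IsLocalRing.mem_maximalIdeal, mem_nonunits_iff, hv.isUnit_iff_valuation_eq_one]
      exact hπ.val_lt_one.ne
    rw [(IsDiscreteValuationRing.irreducible_iff_uniformizer ϖ).mp hϖ, Ideal.mem_span_singleton'] at hmem
    obtain ⟨c, hc⟩ := hmem
    have : valuation F (π : F) = valuation F (c : F) * valuation F (ϖ : F) := by
      rw [← map_mul]
      exact congrArg (valuation F) (congrArg Subtype.val hc).symm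
    rw [← (isUniformizer_iff_valuation_eq_unifValue F (π : F)).mp hπ, this]
    exact mul_le_of_le_one_left' (c.2)

/-- `ord ϖ = 1` for an irreducible `ϖ ∈ 𝒪[F]`. [folklore] -/
theorem ord_eq_one_of_irreducible {ϖ : 𝒪[F]} (hϖ : Irreducible ϖ) : ord F (ϖ : F) = 1 := by
  have h0 : (ϖ : F) ≠ 0 := fun h => hϖ.ne_zero (Subtype.ext h)
  rw [ord_eq_iff F h0, zpow_one]
  exact valuation_eq_unifValue_of_irreducible F hϖ

end Ord

/-! ### Norms from `K`: `ord_F (N_{K/F} a) ∈ f ℤ` -/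

section Norm

variable (F : Type*) [Field F] [ValuativeRel F] [TopologicalSpace F] [IsNonarchimedeanLocalField F]
variable (K : IntermediateField F (AlgebraicClosure F)) [FiniteDimensional F K]

omit [TopologicalSpace F] [IsNonarchimedeanLocalField F] [FiniteDimensional F K] in
/-- **Norms of units of `O_K` are units**: `|N_{K/F}(u)| = 1` for `u ∈ O_Kˣ` (the norm of an integral
element is integral, and `N(u) N(u⁻¹) = 1`). [cite: SerreLocalFields1979, Ch. II §2 Cor. 3 to Prop. 3] -/
theorem valuation_norm_unit (u : (integralClosure 𝒪[F] K)ˣ) :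
    valuation F (Algebra.norm F (((u : integralClosure 𝒪[F] K) : K))) = 1 := by
  have hv := Valuation.integer.integers (valuation F)
  have key : ∀ w : (integralClosure 𝒪[F] K)ˣ, ∃ y : 𝒪[F],
      algebraMap 𝒪[F] F y = Algebra.norm F (((w : integralClosure 𝒪[F] K) : K)) := fun w =>
    IsIntegrallyClosed.algebraMap_eq_of_integral (Algebra.isIntegral_norm F (w : integralClosure 𝒪[F] K).2)
  obtain ⟨y, hy⟩ := key u
  obtain ⟨y', hy'⟩ := key u⁻¹
  have hyy' : y * y' = 1 := by
    apply IsFractionRing.injective 𝒪[F] F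
    rw [map_mul, hy, hy', map_one, ← map_mul, ← Subalgebra.coe_mul, ← Units.val_mul, mul_inv_cancel,
      Units.val_one, Subalgebra.coe_one, map_one]
  have hyu : IsUnit y := isUnit_iff_exists_inv.mpr ⟨y', hyy'⟩
  rw [← hy]
  exact hv.isUnit_iff_valuation_eq_one.mp hyu

/-- **Valuation of norms of integers**: for `K/F` finite separable, `π` a uniformiser of the DVR
`O_K` and `a = v π^k ∈ O_K` (`v` a unit), `ord_F (N_{K/F} a) = f k` with `f` the residue degree
(`e ord(N a) = ord(N(a)^e) = ord(N(v^e u^{-k}) ϖ_F^{nk}) = nk = efk`).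
[cite: SerreLocalFields1979, Ch. II §2 Cor. 3 to Prop. 3 (`v_F(N x) = f v_K(x)`)] -/
theorem ord_norm_eq_of_eq_unit_mul_pow (hKs : K ≤ sepClosure F) {π : integralClosure 𝒪[F] K}
    (hπ : Irreducible π) {a : integralClosure 𝒪[F] K} {v : (integralClosure 𝒪[F] K)ˣ} {k : ℕ}
    (ha : a = v * π ^ k) :
    ord F (Algebra.norm F ((a : K))) = Ideal.inertiaDeg' 𝓂[F] (primeOf F K) * k := by
  haveI := isDiscreteValuationRing_integralClosure' F K hKs
  -- a uniformiser of `F` and its decomposition in `O_K`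
  obtain ⟨ϖ, hϖ⟩ := IsDiscreteValuationRing.exists_irreducible 𝒪[F]
  have hϖ0 : algebraMap 𝒪[F] (integralClosure 𝒪[F] K) ϖ ≠ 0 := by
    intro h
    apply hϖ.ne_zero
    apply IsFractionRing.injective 𝒪[F] F
    apply (algebraMap F K).injective
    have := congrArg (fun z : integralClosure 𝒪[F] K => (z : K)) h
    simpa [Subalgebra.coe_algebraMap, IsScalarTower.algebraMap_apply 𝒪[F] F K] using this
  obtain ⟨e, u, hu⟩ := IsDiscreteValuationRing.eq_unit_mul_pow_irreducible hϖ0 hπ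
  have he : Ideal.ramificationIdx' 𝓂[F] (primeOf F K) = e := ramificationIdx_eq_of_eq_unit_mul_pow F K hKs hϖ hπ hu
  have hef := ramificationIdx_mul_inertiaDeg F K hKs
  rw [he] at hef
  set f := Ideal.inertiaDeg' 𝓂[F] (primeOf F K) with hf_def
  set n := Module.finrank F K with hn_def
  have he0 : e ≠ 0 := by
    intro h0
    rw [h0, zero_mul] at hef
    exact Module.finrank_pos.ne' hef.symm
  -- the identity `a ^ e * u ^ k = v ^ e * ϖ ^ k` in `O_K`
  have hid : a ^ e * (u : integralClosure 𝒪[F] K) ^ k =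
      (v : integralClosure 𝒪[F] K) ^ e * algebraMap 𝒪[F] (integralClosure 𝒪[F] K) ϖ ^ k := by
    rw [ha, hu]; ring
  -- push to `K` and take norms
  have hnorm := congrArg (fun z : integralClosure 𝒪[F] K => Algebra.norm F (z : K)) hid
  simp only [Subalgebra.coe_mul, Subalgebra.coe_pow, map_mul, map_pow, Subalgebra.coe_algebraMap] at hnorm
  rw [IsScalarTower.algebraMap_apply 𝒪[F] F K, Algebra.norm_algebraMap, ← hn_def,
    show (algebraMap 𝒪[F] F) ϖ = (ϖ : F) from rfl] at hnorm
  -- valuations: `ord (N a) * e + 0 = 0 + (k * n) * 1`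
  have hNu := valuation_norm_unit F K u
  have hNv := valuation_norm_unit F K v
  have hNa0 : Algebra.norm F (a : K) ≠ 0 := by
    rw [Algebra.norm_ne_zero_iff]
    intro h
    rw [ha] at h
    have : ((v : integralClosure 𝒪[F] K) * π ^ k : integralClosure 𝒪[F] K) = 0 := Subtype.ext h
    exact (mul_ne_zero v.ne_zero (pow_ne_zero k hπ.ne_zero)) this
  have hu0 : Algebra.norm F (((u : integralClosure 𝒪[F] K) : K)) ≠ 0 := by
    intro h; rw [h, map_zero] at hNu; exact zero_ne_one hNu
  have hv0 : Algebra.norm F (((v : integralClosure 𝒪[F] K) : K)) ≠ 0 := by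
    intro h; rw [h, map_zero] at hNv; exact zero_ne_one hNv
  have hϖ0' : ((ϖ : 𝒪[F]) : F) ≠ 0 := fun h => hϖ.ne_zero (Subtype.ext h)
  have hord := congrArg (ord F) hnorm
  rw [ord_mul F (pow_ne_zero _ hNa0) (pow_ne_zero _ hu0), ord_pow F hNa0, ord_pow F hu0,
    ord_mul F (pow_ne_zero _ hv0) (pow_ne_zero _ (pow_ne_zero _ hϖ0')), ord_pow F hv0,
    ord_pow F (pow_ne_zero _ hϖ0'), ord_pow F hϖ0', ord_eq_one_of_irreducible F hϖ,
    (ord_eq_zero_iff F hu0).mpr hNu, (ord_eq_zero_iff F hv0).mpr hNv] at hord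
  -- `e * ord (N a) = k * n = k * (e * f)`
  have h2 : (e : ℤ) * ord F (Algebra.norm F (a : K)) = e * (f * k) := by
    have : (n : ℤ) = e * f := by rw [← hef]; push_cast; ring
    rw [this] at hord
    linarith
  exact mul_left_cancel₀ (by exact_mod_cast he0) h2

/-- **`ord_F (N_{K/F} Kˣ) ⊆ f ℤ`**, `f` the residue degree of `K/F` (finite separable).
[cite: SerreLocalFields1979, Ch. II §2 Cor. 3 to Prop. 3] -/
theorem inertiaDeg_dvd_ord_norm (hKs : K ≤ sepClosure F) (a : K) (ha : a ≠ 0) :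
    (Ideal.inertiaDeg' 𝓂[F] (primeOf F K) : ℤ) ∣ ord F (Algebra.norm F a) := by
  haveI := isDiscreteValuationRing_integralClosure' F K hKs
  haveI := isFractionRing_integralClosure F K
  obtain ⟨π, hπ⟩ := IsDiscreteValuationRing.exists_irreducible (integralClosure 𝒪[F] K)
  obtain ⟨b, c, hc, rfl⟩ := IsFractionRing.div_surjective (A := integralClosure 𝒪[F] K) a
  have hc0 : c ≠ 0 := nonZeroDivisors.ne_zero hc
  have hb0 : b ≠ 0 := by
    rintro rfl
    exact ha (by simp)
  obtain ⟨kb, vb, hb⟩ := IsDiscreteValuationRing.eq_unit_mul_pow_irreducible hb0 hπ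
  obtain ⟨kc, vc, hcc⟩ := IsDiscreteValuationRing.eq_unit_mul_pow_irreducible hc0 hπ
  have h1 := ord_norm_eq_of_eq_unit_mul_pow F K hKs hπ hb
  have h2 := ord_norm_eq_of_eq_unit_mul_pow F K hKs hπ hcc
  have hNb0 : Algebra.norm F ((b : K)) ≠ 0 := by
    rw [Algebra.norm_ne_zero_iff]; exact fun h => hb0 (Subtype.ext h)
  have hNc0 : Algebra.norm F ((c : K)) ≠ 0 := by
    rw [Algebra.norm_ne_zero_iff]; exact fun h => hc0 (Subtype.ext h)
  change ((Ideal.inertiaDeg' 𝓂[F] (primeOf F K) : ℕ) : ℤ) ∣ ord F (Algebra.norm F ((b : K) / (c : K)))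
  have hcK : (c : K) ≠ 0 := fun h => hc0 (Subtype.ext h)
  have hmul : Algebra.norm F ((b : K) / (c : K)) * Algebra.norm F (c : K) = Algebra.norm F (b : K) := by
    rw [← map_mul, div_mul_cancel₀ _ hcK]
  have hq0 : Algebra.norm F ((b : K) / (c : K)) ≠ 0 := by
    rw [Algebra.norm_ne_zero_iff]
    exact div_ne_zero (fun h => hb0 (Subtype.ext h)) hcK
  have hord := congrArg (ord F) hmul
  rw [ord_mul F hq0 hNc0, h1, h2] at hord
  exact ⟨(kb : ℤ) - kc, by rw [mul_sub]; linarith⟩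

/-- **The residue degree is attained**: `ord_F (N_{K/F} π) = f` for a uniformiser `π` of `O_K`.
[cite: SerreLocalFields1979, Ch. II §2 Cor. 3 to Prop. 3] -/
theorem exists_ord_norm_eq_inertiaDeg (hKs : K ≤ sepClosure F) :
    ∃ a : integralClosure 𝒪[F] K, a ≠ 0 ∧
      ord F (Algebra.norm F ((a : K))) = Ideal.inertiaDeg' 𝓂[F] (primeOf F K) := by
  haveI := isDiscreteValuationRing_integralClosure' F K hKs
  obtain ⟨π, hπ⟩ := IsDiscreteValuationRing.exists_irreducible (integralClosure 𝒪[F] K)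
  refine ⟨π, hπ.ne_zero, ?_⟩
  have h := ord_norm_eq_of_eq_unit_mul_pow F K hKs hπ (a := π) (v := 1) (k := 1) (by simp)
  rw [h, Nat.cast_one, mul_one]

end Norm

end LocalWeilDatum

end Literature.NumberTheory.GaloisRepresentations
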